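import Summits.QuantumAdvantage.AdviceFreeQNC0.EliminationHardnessF
import Summits.QuantumAdvantage.AdviceFreeQNC0.WalkHardFAnchored
import Summits.QuantumAdvantage.AdviceFreeQNC0.OddPrimeWitnesses
import Summits.QuantumAdvantage.AdviceFreeQNC0.WindowLocalHard
import Literature.Computability.MetaComplexity.LowDegreeComposition
import HarnessLib

/-!
# Cell qa-qnc0 (odd primes, rung F-Q2 / R2): ANCHORED strategies — all shots in ONE polylog window,
# selections reading the whole input — lose the u-walk game on a constant fraction, every prime `p ≠ 3`

Planner qa-qnc0-p2 ROUND-13 §3 / `Sketch13p2.lean` §3; statements `Anchored`, `WalkHardFAnchored` are the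
tree's (`WalkHardFAnchored.lean`, seat qn-prover-3, which also derives R2 from R4).  PROVED here DIRECTLY
(no sparsity rung): `walkHardFAnchored (p) (hp3 : p ≠ 3) : WalkHardFAnchored p`.
Mechanism (ROUND-13 §3; prover memo PROVER-MEMO-gen10 §2): for `g ≥ g₀`, `e_g(u) = A(u) + g + δ_g(u)`
with the anchor exponent `A(u) = c + |u| + W_{g₀}(u)` and the window count `δ_g(u) = #{i ∈ [g₀,g) : u_i}`;
so `ringWinU c y u = F_{A(u) mod 3}(u)`, `F_t(u) = [#{g : y_g(u) ∧ t + g + δ_g(u) ≢ 0 (3)} odd]`, which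
depends on `u` only through the `2w` junta data `(y_g(u))_{g∈[g₀,g₀+w)}`, `(u_i)_{i∈[g₀,g₀+w)}`.  By
`chargeTriple` (at the input-dependent charge `t + 2(|u| + W_{g₀}(u))`) some `F_t(u)` is false; with
`t⋆(u)` the least such, `LOSE ⊇ {A(u) ≡ t⋆(u)}`, the level sets of `t⋆` have `𝔽_p`-degree `≤ 2w·D`
(`ind_mem_lowDeg_of_determined` = junta-degree lemma + composition), and
`A(u) ≡ c + 2g₁ + |u ⊕ 1_{[0,g₀)}|` — after the affine flip `v = u ⊕ 1_{[0,g₀)}` a LEVEL-SET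
ELIMINATION event for `|v| mod 3`, of size `≥ η₀·2ⁿ` by `elimHardF` (`EliminationHardnessF.lean`).
WHAT THIS IS NOT: many windows / dense support (`WalkHardF p`, `p ≥ 5`) OPEN; separation NOT moved.
-/

noncomputable section

namespace Summit.QuantumAdvantage.AdviceFreeQNC0
open Classical
open Finset
open Literature.Computability.MetaComplexity Literature.Computability.MetaComplexity.Smolensky

variable {n : ℕ}

/-- **Determined-by lemma**: a Boolean function determined by `k` Boolean functions whose indicators
have `F`-degree `≤ D` has an indicator of `F`-degree `≤ k·D` (junta-degree lemma + composition). -/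
theorem ind_mem_lowDeg_of_determined {F : Type*} [Field F] {k D : ℕ}
    (z : Fin k → (Fin n → Bool) → Bool)
    (hz : ∀ j, (fun u => if z j u = true then (1 : F) else 0) ∈ lowDeg F n D)
    (f : (Fin n → Bool) → Bool) (hf : ∀ u v : Fin n → Bool, (∀ j, z j u = z j v) → f u = f v) :
    (fun u => if f u = true then (1 : F) else 0) ∈ lowDeg F n (k * D) := by
  let Z : (Fin n → Bool) → (Fin k → Bool) := fun u j => z j u
  let φ : (Fin k → Bool) → Bool := fun b => if h : ∃ u, Z u = b then f h.choose else false
  have hφu : ∀ u, φ (Z u) = f u := by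
    intro u
    have h : ∃ u', Z u' = Z u := ⟨u, rfl⟩
    show (if h : ∃ u', Z u' = Z u then f h.choose else false) = f u
    rw [dif_pos h]
    exact hf _ _ fun j => congrFun h.choose_spec j
  have hφdeg : (fun b : Fin k → Bool => if φ b = true then (1 : F) else 0) ∈ lowDeg F k k := by
    have h := ind_mem_lowDeg_of_dependsOn (F := F) univ φ fun b b' h => by
      rw [show b = b' from funext fun j => h j (mem_univ j)]
    rwa [Finset.card_univ, Fintype.card_fin] at h
  have he : ∀ j, (fun u => if Z u j = true then (1 : F) else 0) ∈ lowDeg F n D := fun j => hz j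
  have hcomp := comp_mem_lowDeg_of_coord_mul (F := F) Z he hφdeg
  have e : (fun u => if f u = true then (1 : F) else 0) =
      fun u => (fun b : Fin k → Bool => if φ b = true then (1 : F) else 0) (Z u) := by
    funext u; simp only [hφu u]
  rw [e]; exact hcomp

section Game

variable (g₀ : ℕ)

/-- The window count `δ_g(u) = #{i ∈ [g₀, g) : u_i = 1}`. -/
def winCnt (u : Fin n → Bool) (g : ℕ) : ℕ :=
  (univ.filter fun i : Fin n => g₀ ≤ i.val ∧ i.val < g ∧ u i = true).card

/-- `W_g = W_{g₀} + δ_g` for `g ≥ g₀`. -/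
theorem wtPrefix_eq_add (u : Fin n → Bool) {g : ℕ} (hg : g₀ ≤ g) :
    wtPrefix u g = wtPrefix u g₀ + winCnt g₀ u g := by
  unfold wtPrefix winCnt
  rw [← Finset.card_union_of_disjoint]
  · congr 1
    ext i
    simp only [mem_filter, mem_univ, true_and, mem_union]
    constructor
    · rintro ⟨hi, hu⟩
      by_cases h : i.val < g₀
      · exact Or.inl ⟨h, hu⟩
      · exact Or.inr ⟨by omega, hi, hu⟩
    · rintro (⟨hi, hu⟩ | ⟨_, hi, hu⟩)
      · exact ⟨by omega, hu⟩
      · exact ⟨hi, hu⟩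
  · rw [Finset.disjoint_filter]
    intro i _ h1 h2
    omega

/-- The shifted win bit `F_t(u) = [#{g : y_g(u) ∧ t + g + δ_g(u) ≢ 0 (3)} odd]`. -/
def Fshift (t : ℕ) (y : Fin (n + 1) → (Fin n → Bool) → Bool) (u : Fin n → Bool) : Bool :=
  decide ((univ.filter fun g : Fin (n + 1) =>
    y g u = true ∧ (t + g.val + winCnt g₀ u g.val) % 3 ≠ 0).card % 2 = 1)

/-- The anchor data `A'(u) = |u| + W_{g₀}(u)` (so `A(u) = c + A'(u)`). -/
def anchorExp (u : Fin n → Bool) : ℕ := wt u + wtPrefix u g₀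
variable {g₀} {w : ℕ} {y : Fin (n + 1) → (Fin n → Bool) → Bool}

/-- **Shift form**: for an anchored strategy, the game at charge `c'` is `F_t` whenever
`c' + A'(u) ≡ t (mod 3)`. -/
theorem ringWinU_eq_Fshift (hy : Anchored g₀ w y) (u : Fin n → Bool) {c' t : ℕ}
    (h : (c' + anchorExp g₀ u) % 3 = t % 3) : ringWinU c' y u = Fshift g₀ t y u := by
  have hset : (univ.filter fun g : Fin (n + 1) =>
      y g u = true ∧ (c' + g.val + walkExp u g.val) % 3 ≠ 0) =
      univ.filter fun g : Fin (n + 1) => y g u = true ∧ (t + g.val + winCnt g₀ u g.val) % 3 ≠ 0 := by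
    refine filter_congr fun g _ => ?_
    constructor
    · rintro ⟨hyg, hne⟩
      refine ⟨hyg, ?_⟩
      have hg := (hy g u hyg).1
      rw [walkExp, wtPrefix_eq_add g₀ u hg] at hne
      unfold anchorExp at h
      omega
    · rintro ⟨hyg, hne⟩
      refine ⟨hyg, ?_⟩
      have hg := (hy g u hyg).1
      rw [walkExp, wtPrefix_eq_add g₀ u hg]
      unfold anchorExp at h
      omega
  unfold ringWinU Fshift; rw [hset]

/-- Some shift loses (from `chargeTriple` at the charge `t + 2A'(u)`). -/
theorem exists_Fshift_false (hy : Anchored g₀ w y) (u : Fin n → Bool) :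
    ∃ t : ℕ, t < 3 ∧ Fshift g₀ t y u = false := by
  have hct := chargeTriple n (2 * anchorExp g₀ u) y u
  by_contra hall
  have h3 : (univ.filter fun ρ : Fin 3 => ringWinU (2 * anchorExp g₀ u + ρ.val) y u = true) = univ := by
    refine Finset.filter_true_of_mem fun ρ _ => ?_
    rw [ringWinU_eq_Fshift hy u (t := ρ.val) (by omega)]
    cases hF : Fshift g₀ ρ.val y u
    · exact absurd ⟨ρ.val, ρ.isLt, hF⟩ hall
    · rfl
  rw [h3, card_univ, Fintype.card_fin] at hct
  omega

/-- The least losing shift `t⋆(u) ∈ {0, 1, 2}`. -/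
def tstar (g₀ : ℕ) (y : Fin (n + 1) → (Fin n → Bool) → Bool) (u : Fin n → Bool) : ℕ :=
  if Fshift g₀ 0 y u = false then 0 else if Fshift g₀ 1 y u = false then 1 else 2

/-- `t⋆(u) < 3`. -/
theorem tstar_lt (u : Fin n → Bool) : tstar g₀ y u < 3 := by
  unfold tstar; split_ifs <;> omega
/-- `F_{t⋆(u)}(u) = false`. -/
theorem Fshift_tstar (hy : Anchored g₀ w y) (u : Fin n → Bool) :
    Fshift g₀ (tstar g₀ y u) y u = false := by
  obtain ⟨t, ht, hF⟩ := exists_Fshift_false hy u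
  unfold tstar
  by_cases h0 : Fshift g₀ 0 y u = false
  · rw [if_pos h0]; exact h0
  rw [if_neg h0]
  by_cases h1 : Fshift g₀ 1 y u = false
  · rw [if_pos h1]; exact h1
  rw [if_neg h1]
  rcases (show t = 0 ∨ t = 1 ∨ t = 2 by omega) with rfl | rfl | rfl
  · exact absurd hF h0
  · exact absurd hF h1
  · exact hF

/-- **The losing event**: if `c + A'(u) ≡ t⋆(u) (mod 3)` then the anchored strategy loses at `u`. -/
theorem lose_of_anchor (hy : Anchored g₀ w y) {c : ℕ} {u : Fin n → Bool}
    (h : (c + anchorExp g₀ u) % 3 = tstar g₀ y u) : ringWinU c y u = false := by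
  rw [ringWinU_eq_Fshift hy u (t := tstar g₀ y u) (by rw [h, Nat.mod_eq_of_lt (tstar_lt u)])]
  exact Fshift_tstar hy u

/-- The `2w` junta data: `j < w ↦ y_{g₀+j}(u)`, `w ≤ j ↦ u_{g₀ + (j − w)}` (out-of-range: `false`). -/
def junta (g₀ w : ℕ) (y : Fin (n + 1) → (Fin n → Bool) → Bool) (j : Fin (w + w))
    (u : Fin n → Bool) : Bool :=
  if j.val < w then (if hg : g₀ + j.val < n + 1 then y ⟨g₀ + j.val, hg⟩ u else false)
  else (if hi : g₀ + (j.val - w) < n then u ⟨g₀ + (j.val - w), hi⟩ else false)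

/-- Each junta coordinate has an indicator of degree `≤ D` (`D ≥ 1`). -/
theorem junta_mem_lowDeg {p : ℕ} [Fact p.Prime] {D : ℕ} (hD : 1 ≤ D)
    (hdeg : ∀ g, HasDegF p (y g) D) (j : Fin (w + w)) :
    (fun u => if junta g₀ w y j u = true then (1 : ZMod p) else 0) ∈ lowDeg (ZMod p) n D := by
  unfold junta
  by_cases hj : j.val < w
  · simp only [hj, if_true]
    by_cases hg : g₀ + j.val < n + 1
    · simp only [hg, dif_pos]
      exact hdeg _
    · simp only [hg, dif_neg, not_false_eq_true, Bool.false_eq_true, if_false]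
      exact Submodule.zero_mem _
  · simp only [hj, if_false]
    by_cases hi : g₀ + (j.val - w) < n
    · simp only [hi, dif_pos]
      have e : (fun u : Fin n → Bool => if u ⟨g₀ + (j.val - w), hi⟩ = true then (1 : ZMod p) else 0) =
          mono (ZMod p) {⟨g₀ + (j.val - w), hi⟩} := by
        funext u; rw [mono_apply]; simp
      rw [e]
      exact mono_mem_lowDeg (le_trans (by simp) hD)
    · simp only [hi, dif_neg, not_false_eq_true, Bool.false_eq_true, if_false]
      exact Submodule.zero_mem _

/-- Inputs with the same junta data have the same window counts `δ_g`, `g < g₀ + w`. -/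
theorem winCnt_eq_of_junta {u v : Fin n → Bool} (h : ∀ j, junta g₀ w y j u = junta g₀ w y j v)
    {g : ℕ} (hg : g ≤ g₀ + w) : winCnt g₀ u g = winCnt g₀ v g := by
  unfold winCnt
  congr 1
  refine filter_congr fun i _ => ?_
  have key : g₀ ≤ i.val → i.val < g → u i = v i := by
    intro h1 h2
    have hj : w + (i.val - g₀) < w + w := by omega
    have := h ⟨w + (i.val - g₀), hj⟩
    unfold junta at this
    simp only [show ¬ (w + (i.val - g₀) < w) by omega, if_false,
      show w + (i.val - g₀) - w = i.val - g₀ by omega,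
      show g₀ + (i.val - g₀) < n by omega, dif_pos] at this
    have e : (⟨g₀ + (i.val - g₀), by omega⟩ : Fin n) = i := Fin.ext (by simp; omega)
    rw [e] at this
    exact this
  constructor
  · rintro ⟨h1, h2, hu⟩; exact ⟨h1, h2, by rw [← key h1 h2]; exact hu⟩
  · rintro ⟨h1, h2, hv⟩; exact ⟨h1, h2, by rw [key h1 h2]; exact hv⟩

/-- Inputs with the same junta data have the same shifted win bits. -/
theorem Fshift_eq_of_junta (hy : Anchored g₀ w y) (t : ℕ) {u v : Fin n → Bool}
    (h : ∀ j, junta g₀ w y j u = junta g₀ w y j v) : Fshift g₀ t y u = Fshift g₀ t y v := by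
  have hset : (univ.filter fun g : Fin (n + 1) => y g u = true ∧ (t + g.val + winCnt g₀ u g.val) % 3 ≠ 0) =
      univ.filter fun g : Fin (n + 1) => y g v = true ∧ (t + g.val + winCnt g₀ v g.val) % 3 ≠ 0 := by
    refine filter_congr fun g _ => ?_
    by_cases hyu : y g u = true
    · obtain ⟨h1, h2⟩ := hy g u hyu
      have hj : g.val - g₀ < w + w := by omega
      have hz := h ⟨g.val - g₀, hj⟩
      unfold junta at hz
      simp only [show g.val - g₀ < w by omega, if_true, show g₀ + (g.val - g₀) < n + 1 by omega,
        dif_pos] at hz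
      have e : (⟨g₀ + (g.val - g₀), by omega⟩ : Fin (n + 1)) = g := Fin.ext (by simp; omega)
      rw [e] at hz
      rw [winCnt_eq_of_junta h (by omega : g.val ≤ g₀ + w), hz]
    · have hyv : ¬ y g v = true := by
        intro hyv
        obtain ⟨h1, h2⟩ := hy g v hyv
        have hj : g.val - g₀ < w + w := by omega
        have hz := h ⟨g.val - g₀, hj⟩
        unfold junta at hz
        simp only [show g.val - g₀ < w by omega, if_true, show g₀ + (g.val - g₀) < n + 1 by omega,
          dif_pos] at hz
        have e : (⟨g₀ + (g.val - g₀), by omega⟩ : Fin (n + 1)) = g := Fin.ext (by simp; omega)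
        rw [e] at hz
        rw [hz] at hyu
        exact hyu hyv
      simp [hyu, hyv]
  unfold Fshift; rw [hset]

/-- **The level sets of `t⋆` have `𝔽_p`-degree `≤ 2w·D`.** -/
theorem tstar_level_mem_lowDeg {p : ℕ} [Fact p.Prime] {D : ℕ} (hD : 1 ≤ D) (hy : Anchored g₀ w y)
    (hdeg : ∀ g, HasDegF p (y g) D) (r : ℕ) :
    (fun u => if tstar g₀ y u = r then (1 : ZMod p) else 0) ∈ lowDeg (ZMod p) n ((w + w) * D) := by
  have h := ind_mem_lowDeg_of_determined (F := ZMod p) (junta g₀ w y)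
    (junta_mem_lowDeg hD hdeg) (fun u => decide (tstar g₀ y u = r)) (fun u v huv => by
      have h0 := Fshift_eq_of_junta hy 0 huv
      have h1 := Fshift_eq_of_junta hy 1 huv
      unfold tstar
      rw [h0, h1])
  have e : (fun u => if tstar g₀ y u = r then (1 : ZMod p) else 0) =
      fun u => if decide (tstar g₀ y u = r) = true then (1 : ZMod p) else 0 := by
    funext u; simp only [decide_eq_true_eq]
  rw [e]; exact h

/-- Flip the bits before `g₀`: `v_i = u_i ⊕ [i < g₀]`. -/
def flipPre (g₀ : ℕ) (u : Fin n → Bool) : Fin n → Bool := fun i => xor (u i) (decide (i.val < g₀))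

/-- `flipPre` is an involution. -/
theorem flipPre_flipPre (u : Fin n → Bool) : flipPre g₀ (flipPre g₀ u) = u := by
  funext i; unfold flipPre; cases u i <;> cases decide (i.val < g₀) <;> rfl
/-- `g₁ = #{i < n : i < g₀}`. -/
def preLen (n g₀ : ℕ) : ℕ := (univ.filter fun i : Fin n => i.val < g₀).card
/-- **`|flipPre u| + 2·W_{g₀}(u) = g₁ + |u|`.** -/
theorem wt_flipPre (u : Fin n → Bool) :
    wt (flipPre g₀ u) + 2 * wtPrefix u g₀ = preLen n g₀ + wt u := by
  -- split everything at `g₀`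
  have hwt : wt u = wtPrefix u g₀ + (univ.filter fun i : Fin n => ¬ i.val < g₀ ∧ u i = true).card := by
    unfold wt wtPrefix
    rw [← Finset.card_union_of_disjoint]
    · congr 1; ext i; simp only [mem_filter, mem_univ, true_and, mem_union]
      constructor
      · intro hu; by_cases h : i.val < g₀
        · exact Or.inl ⟨h, hu⟩
        · exact Or.inr ⟨h, hu⟩
      · rintro (⟨_, hu⟩ | ⟨_, hu⟩) <;> exact hu
    · rw [Finset.disjoint_filter]; intro i _ h1 h2; exact h2.1 h1.1
  have hfl : wt (flipPre g₀ u) = (univ.filter fun i : Fin n => i.val < g₀ ∧ u i = false).card +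
      (univ.filter fun i : Fin n => ¬ i.val < g₀ ∧ u i = true).card := by
    unfold wt
    rw [← Finset.card_union_of_disjoint]
    · congr 1; ext i; simp only [mem_filter, mem_univ, true_and, mem_union, flipPre]
      by_cases h : i.val < g₀
      · simp only [h, decide_true, Bool.xor_true, Bool.not_eq_true', not_true, false_and, or_false,
          true_and]
      · simp only [h, decide_false, Bool.xor_false, not_false_eq_true, true_and, false_and, false_or]
    · rw [Finset.disjoint_filter]; intro i _ h1 h2; exact h2.1 h1.1
  have hpre : wtPrefix u g₀ + (univ.filter fun i : Fin n => i.val < g₀ ∧ u i = false).card =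
      preLen n g₀ := by
    unfold wtPrefix preLen
    rw [← Finset.card_union_of_disjoint]
    · congr 1; ext i; simp only [mem_filter, mem_univ, true_and, mem_union]
      constructor
      · rintro (⟨h, _⟩ | ⟨h, _⟩) <;> exact h
      · intro h; cases hu : u i
        · exact Or.inr ⟨h, rfl⟩
        · exact Or.inl ⟨h, rfl⟩
    · rw [Finset.disjoint_filter]; rintro i _ ⟨_, h1⟩ ⟨_, h2⟩; rw [h1] at h2; exact Bool.noConfusion h2
  omega

/-- Each coordinate of `flipPre` has an indicator of degree `≤ 1`. -/
theorem ind_flipPre_mem {F : Type*} [Field F] (i : Fin n) :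
    (fun v : Fin n → Bool => if flipPre g₀ v i = true then (1 : F) else 0) ∈ lowDeg F n 1 := by
  unfold flipPre
  by_cases h : i.val < g₀
  · have e : (fun v : Fin n → Bool => if xor (v i) (decide (i.val < g₀)) = true then (1 : F) else 0) =
        1 - mono F {i} := by
      funext v; rw [Pi.sub_apply, Pi.one_apply, mono_apply]; simp only [h, decide_true, mem_singleton,
        forall_eq]; cases v i <;> simp
    rw [e]; exact Submodule.sub_mem _ (one_mem_lowDeg 1) (mono_mem_lowDeg (by simp))
  · have e : (fun v : Fin n → Bool => if xor (v i) (decide (i.val < g₀)) = true then (1 : F) else 0) =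
        mono F {i} := by
      funext v; rw [mono_apply]; simp only [h, decide_false, Bool.xor_false, mem_singleton, forall_eq]
    rw [e]; exact mono_mem_lowDeg (by simp)

end Game

/-- **`WalkHardFAnchored p` — PROVED for every prime `p ≠ 3`** (`θ = 1 − η₀(p)` from `elimHardF`). -/
theorem walkHardFAnchored (p : ℕ) [Fact p.Prime] (hp3 : p ≠ 3) : WalkHardFAnchored p := by
  obtain ⟨η₀, hη₀, hE⟩ := elimHardF p hp3
  refine ⟨1 - η₀, by linarith, fun C => ?_⟩
  obtain ⟨n₁, hn₁⟩ := hE (2 * C + 1)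
  refine ⟨max n₁ 4, fun n hn c g₀ y hy hdeg => ?_⟩
  have hn4 : 4 ≤ n := le_trans (le_max_right _ _) hn
  set D := (Nat.log 2 n) ^ C with hD
  have hlog : 2 ≤ Nat.log 2 n := Nat.le_log_of_pow_le (by norm_num) (by omega)
  have hD1 : 1 ≤ D := Nat.one_le_pow _ _ (by omega)
  have hdegle : (D + D) * D ≤ (Nat.log 2 n) ^ (2 * C + 1) := by
    rw [hD, show (Nat.log 2 n ^ C + Nat.log 2 n ^ C) * Nat.log 2 n ^ C = 2 * (Nat.log 2 n ^ (2 * C))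
      by ring, pow_succ, mul_comm]
    exact Nat.mul_le_mul_left _ hlog
  -- the eliminator `e(v) = t⋆(flip v) − (c + 2 g₁)` (mod 3)
  set c₂ : ℕ := c + 2 * preLen n g₀ with hc₂
  set e : (Fin n → Bool) → ℕ := fun v => tstar g₀ y (flipPre g₀ v) + (3 - c₂ % 3) with he
  -- its level sets are low degree
  have hlev : ∀ r : ℕ, (fun v => if e v % 3 = r % 3 then (1 : ZMod p) else 0) ∈
      lowDeg (ZMod p) n ((Nat.log 2 n) ^ (2 * C + 1)) := by
    intro r
    have ht := tstar_level_mem_lowDeg (w := D) hD1 hy hdeg ((r + c₂) % 3)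
    have hcomp := comp_mem_lowDeg_of_coord (F := ZMod p) (flipPre g₀) (ind_flipPre_mem (g₀ := g₀)) ht
    refine lowDeg_mono hdegle ?_
    have eq : (fun v => if e v % 3 = r % 3 then (1 : ZMod p) else 0) =
        fun v => (fun u => if tstar g₀ y u = (r + c₂) % 3 then (1 : ZMod p) else 0) (flipPre g₀ v) := by
      funext v
      have hlt := tstar_lt (g₀ := g₀) (y := y) (flipPre g₀ v)
      simp only [he]
      by_cases hc : tstar g₀ y (flipPre g₀ v) = (r + c₂) % 3
      · rw [if_pos hc, if_pos]; omega
      · rw [if_neg hc, if_neg]; omega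
    rw [eq]; exact hcomp
  have hcount := hn₁ n (le_trans (le_max_left _ _) hn) e hlev
  -- the elimination event is a losing event (after flipping back)
  have hsub : ((univ.filter fun v : Fin n → Bool => e v % 3 = Hegedus.wt v % 3).card : ℝ) ≤
      ((univ.filter fun u : Fin n → Bool => ¬ ringWinU c y u = true).card : ℝ) := by
    have hle : (univ.filter fun v : Fin n → Bool => e v % 3 = Hegedus.wt v % 3).card ≤
        (univ.filter fun u : Fin n → Bool => ¬ ringWinU c y u = true).card := by
      refine Finset.card_le_card_of_injOn (flipPre g₀) ?_ ?_
      · intro v hv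
        rw [Finset.mem_coe, mem_filter] at hv ⊢
        refine ⟨mem_univ _, ?_⟩
        have hw : Hegedus.wt v = wt v := rfl
        have hid := wt_flipPre (g₀ := g₀) (flipPre g₀ v)
        rw [flipPre_flipPre] at hid
        have hlt := tstar_lt (g₀ := g₀) (y := y) (flipPre g₀ v)
        have hA : (c + anchorExp g₀ (flipPre g₀ v)) % 3 = tstar g₀ y (flipPre g₀ v) := by
          unfold anchorExp
          have := hv.2
          simp only [he, hw] at this
          omega
        rw [lose_of_anchor hy hA]
        simp
      · intro v₁ _ v₂ _ h
        rw [← flipPre_flipPre (g₀ := g₀) v₁, ← flipPre_flipPre (g₀ := g₀) v₂, h]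
    exact_mod_cast hle
  have hwin : ((univ.filter fun u : Fin n → Bool => ringWinU c y u = true).card : ℝ) +
      ((univ.filter fun u : Fin n → Bool => ¬ ringWinU c y u = true).card : ℝ) = (2 : ℝ) ^ n := by
    have h := Finset.card_filter_add_card_filter_not (s := (univ : Finset (Fin n → Bool)))
      (fun u => ringWinU c y u = true)
    rw [card_univ, Fintype.card_fun, Fintype.card_bool, Fintype.card_fin] at h
    exact_mod_cast h
  linarith

end Summit.QuantumAdvantage.AdviceFreeQNC0

end
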